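import Literature.Combinatorics.Additive.TPPTableGL2
import HarnessLib

/-!
# A table-level TPP test, and certified TPP triples of `GL₂(𝔽₃)` and `SL₂(𝔽₃)`

The positive half of the SAT pipeline of `TripleProductPropertySAT.lean`: a satisfying assignment
found by the solver names three sets of table points; `GroupTable.tppTestB` is the Boolean triple
product test on those points (the brute-force quotient test of Hedtke–Murthy 2012, §5, on
`|S|²|T|²|U|²` sextuples, in table arithmetic, so `decide +kernel` evaluates it cheaply), and
`exists_tpp_of_tppTestB` transports a passed test through a partial table `T.IsPartialTableOf G ι`
to actual subsets of the group `G` with the triple product property and the listed cardinalities.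

Certified instances, from the models the solver returned for `tppCNF (gl2Table 3) a b c`:
`GL₂(𝔽₃)` (order `48`) realizes `⟨4, 4, 4⟩` (`gl2f3_realizes_444`; `64 > 48`), `⟨5, 4, 3⟩`
(`gl2f3_realizes_543`) and `⟨6, 4, 3⟩`, `⟨6, 6, 2⟩`, `⟨8, 3, 3⟩` (`gl2f3_realizes_643/662/833`,
product `72 = 3|G|/2`, so its pseudo-exponent is at most `3 log 48 / log 72 < 2.72`);
its subgroup `SL₂(𝔽₃)` (order `24`) realizes `⟨4, 3, 3⟩` (`sl2f3_realizes_433`, `36 = 3|G|/2`).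
(For orientation only, not certified here: on the grid `8 ≥ a ≥ b ≥ c ≥ 2` the solver reports
every threshold with `abc > 72` — and `⟨5, 4, 4⟩`, `⟨5, 5, 3⟩` — unsatisfiable for `GL₂(𝔽₃)`;
those refutations run to `10⁶–10⁹` bytes of LRAT and are not imported.)
Points are radix-`3` codes `27a + 9b + 3c + d` of matrices `(a b; c d)` (`TPPTableGL2.quadEquiv`);
`28` is the identity.

## References

* H. Cohn, C. Umans, FOCS 2003, Def. 2.1 (TPP), Def. 2.2/§3 (pseudo-exponent).
  [cite: CohnUmans2003, Def. 2.1]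
* I. Hedtke, S. Murthy, Groups Complex. Cryptol. 4 (2012), Def. 1.2 and §5 (TPP tests).
  [cite: HedtkeMurthy2012, Def. 1.2]
-/

namespace Literature.Combinatorics.Additive

open Literature.Computability.Complexity

universe u

variable {N : ℕ}

/-- **Boolean TPP test on table points** (brute force over sextuples, quotient form of the TPP):
for all `s, s' ∈ lS`, `t, t' ∈ lT`, `u, u' ∈ lU`, either `(s s'⁻¹)(t t'⁻¹)(u u'⁻¹) ≠ 1` in the
table, or `s = s'`, `t = t'`, `u = u'`. [cite: HedtkeMurthy2012, Def. 1.2] -/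
def GroupTable.tppTestB (T : GroupTable N) (lS lT lU : List (Fin N)) : Bool :=
  lS.all fun s => lS.all fun s' => lT.all fun t => lT.all fun t' => lU.all fun u => lU.all fun u' =>
    !(T.mul (T.mul (T.mul s (T.inv s')) (T.mul t (T.inv t'))) (T.mul u (T.inv u')) == T.one) ||
      (s == s' && t == t' && u == u')

/-- The subset of `G` whose codes lie in the list `l`. [folklore] -/
def setOfCodes {G : Type u} [Fintype G] (ι : G → Fin N) (l : List (Fin N)) : Finset G :=
  Finset.univ.filter fun g => ι g ∈ l

/-- Membership in `setOfCodes`. [folklore] -/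
theorem mem_setOfCodes_iff {G : Type u} [Fintype G] {ι : G → Fin N} {l : List (Fin N)} {g : G} :
    g ∈ setOfCodes ι l ↔ ι g ∈ l := by
  simp [setOfCodes]

/-- The cardinality of `setOfCodes ι l` is the length of `l` when `l` is duplicate free and
consists of valid points of a partial table along `ι`. [folklore] -/
theorem card_setOfCodes {G : Type u} [Group G] [Fintype G] {T : GroupTable N} {ι : G → Fin N}
    (hT : T.IsPartialTableOf G ι) {l : List (Fin N)} (hnd : l.Nodup)
    (hvalid : ∀ i ∈ l, T.valid i = true) : (setOfCodes ι l).card = l.length := by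
  classical
  rw [← Finset.card_image_of_injective (setOfCodes ι l) hT.injective, ← List.toFinset_card_of_nodup hnd]
  congr 1
  ext i
  simp only [Finset.mem_image, mem_setOfCodes_iff, List.mem_toFinset]
  constructor
  · rintro ⟨g, hg, rfl⟩
    exact hg
  · intro hi
    obtain ⟨g, rfl⟩ := (hT.valid_iff i).1 (hvalid i hi)
    exact ⟨g, hi, rfl⟩

/-- **Soundness of the table TPP test**: if the codes `lS, lT, lU` (duplicate free, valid) pass
`tppTestB` for a partial table of `G`, then the corresponding subsets of `G` have the triple product
property and the listed sizes. [cite: HedtkeMurthy2012, Def. 1.2] -/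
theorem exists_tpp_of_tppTestB {G : Type u} [Group G] [Fintype G] {T : GroupTable N}
    {ι : G → Fin N} (hT : T.IsPartialTableOf G ι) {lS lT lU : List (Fin N)}
    (htest : T.tppTestB lS lT lU = true) (hS : lS.Nodup) (hTn : lT.Nodup) (hU : lU.Nodup)
    (hvalid : ∀ i ∈ lS ++ lT ++ lU, T.valid i = true) :
    ∃ S₁ S₂ S₃ : Finset G, TripleProductProperty S₁ S₂ S₃ ∧ S₁.card = lS.length ∧
      S₂.card = lT.length ∧ S₃.card = lU.length := by
  refine ⟨setOfCodes ι lS, setOfCodes ι lT, setOfCodes ι lU, ?_,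
    card_setOfCodes hT hS fun i hi => hvalid i (by simp [hi]),
    card_setOfCodes hT hTn fun i hi => hvalid i (by simp [hi]),
    card_setOfCodes hT hU fun i hi => hvalid i (by simp [hi])⟩
  intro s hs s' hs' t ht t' ht' u hu u' hu' hprod
  rw [mem_setOfCodes_iff] at hs hs' ht ht' hu hu'
  simp only [GroupTable.tppTestB, List.all_eq_true] at htest
  have key := htest _ hs _ hs' _ ht _ ht' _ hu _ hu'
  have hcode : T.mul (T.mul (T.mul (ι s) (T.inv (ι s'))) (T.mul (ι t) (T.inv (ι t'))))
      (T.mul (ι u) (T.inv (ι u'))) = T.one := by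
    simp only [hT.inv_eq, hT.mul_eq, hprod, hT.one_eq]
  simp only [hcode, beq_self_eq_true, Bool.not_true, Bool.false_or, Bool.and_eq_true,
    beq_iff_eq] at key
  exact ⟨hT.injective key.1.1, hT.injective key.1.2, hT.injective key.2⟩

/-! ### `GL₂(𝔽₃)` -/

/-- **`GL₂(𝔽₃)` realizes `⟨4, 4, 4⟩`**: the invertible matrices with radix-`3` codes
`S = {28, 43, 56, 77}`, `T = {26, 28, 67, 73}`, `U = {28, 64, 78, 79}` (`28` = identity) form a TPP
triple, so a group of order `48` carries a TPP triple with `|S||T||U| = 64 > 48` (found as a model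
of `tppCNF (gl2Table 3) 4 4 4`; the test is re-run by the kernel). [cite: CohnUmans2003, Def. 2.1] -/
theorem gl2f3_realizes_444 :
    ∃ S T U : Finset (Matrix.GeneralLinearGroup (Fin 2) (ZMod 3)),
      TripleProductProperty S T U ∧ S.card = 4 ∧ T.card = 4 ∧ U.card = 4 :=
  exists_tpp_of_tppTestB (gl2Table_isPartialTableOf 3) (lS := [28, 43, 56, 77])
    (lT := [26, 28, 67, 73]) (lU := [28, 64, 78, 79]) (by decide +kernel) (by decide) (by decide)
    (by decide) (by decide +kernel)

/-- **`GL₂(𝔽₃)` realizes `⟨5, 4, 3⟩`**: codes `S = {12, 15, 28, 32, 64}`, `T = {28, 41, 56, 79}`,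
`U = {28, 31, 34}` (product `60 > 48`). [cite: CohnUmans2003, Def. 2.1] -/
theorem gl2f3_realizes_543 :
    ∃ S T U : Finset (Matrix.GeneralLinearGroup (Fin 2) (ZMod 3)),
      TripleProductProperty S T U ∧ S.card = 5 ∧ T.card = 4 ∧ U.card = 3 :=
  exists_tpp_of_tppTestB (gl2Table_isPartialTableOf 3) (lS := [12, 15, 28, 32, 64])
    (lT := [28, 41, 56, 79]) (lU := [28, 31, 34]) (by decide +kernel) (by decide) (by decide)
    (by decide) (by decide +kernel)

/-! ### `SL₂(𝔽₃)` -/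

/-- **`SL₂(𝔽₃)` (order `24`) realizes `⟨4, 3, 3⟩`**: inside the kernel of the determinant on
`GL₂(𝔽₃)`, the matrices with radix-`3` codes `S = {28, 34, 65, 75}`, `T = {23, 28, 69}`,
`U = {28, 37, 46}` (all of determinant `1`; `28` = identity) form a TPP triple with
`|S||T||U| = 36 = 3|G|/2` (a model of `tppCNF (sl2Table 3) 4 3 3`; the test is re-run by the
kernel through the sub-table `sl2Table_isPartialTableOf`). [cite: CohnUmans2003, Def. 2.1] -/
theorem sl2f3_realizes_433 :
    ∃ S T U : Finset (Matrix.GeneralLinearGroup.det (n := Fin 2) (R := ZMod 3)).ker,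
      TripleProductProperty S T U ∧ S.card = 4 ∧ T.card = 3 ∧ U.card = 3 :=
  exists_tpp_of_tppTestB (sl2Table_isPartialTableOf 3) (lS := [28, 34, 65, 75])
    (lT := [23, 28, 69]) (lU := [28, 37, 46]) (by decide +kernel) (by decide) (by decide)
    (by decide) (by decide +kernel)

/-! ### `GL₂(𝔽₃)`: triples with `|S||T||U| = 72 = 3|G|/2` -/

/-- **`GL₂(𝔽₃)` realizes `⟨6, 4, 3⟩`** (product `72 = 3|G|/2`): codes
`S = {28, 29, 37, 38, 46, 47}`, `T = {28, 71, 74, 79}`, `U = {17, 24, 28}` (a model of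
`tppCNF (gl2Table 3) 6 4 3`, re-checked by the kernel). [cite: CohnUmans2003, Def. 2.1] -/
theorem gl2f3_realizes_643 :
    ∃ S T U : Finset (Matrix.GeneralLinearGroup (Fin 2) (ZMod 3)),
      TripleProductProperty S T U ∧ S.card = 6 ∧ T.card = 4 ∧ U.card = 3 :=
  exists_tpp_of_tppTestB (gl2Table_isPartialTableOf 3) (lS := [28, 29, 37, 38, 46, 47])
    (lT := [28, 71, 74, 79]) (lU := [17, 24, 28]) (by decide +kernel) (by decide) (by decide)
    (by decide) (by decide +kernel)

/-- **`GL₂(𝔽₃)` realizes `⟨6, 6, 2⟩`** (product `72`): codes `S = {23, 24, 28, 32, 64, 69}`,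
`T = {28, 29, 34, 58, 61, 62}`, `U = {28, 73}`. [cite: CohnUmans2003, Def. 2.1] -/
theorem gl2f3_realizes_662 :
    ∃ S T U : Finset (Matrix.GeneralLinearGroup (Fin 2) (ZMod 3)),
      TripleProductProperty S T U ∧ S.card = 6 ∧ T.card = 6 ∧ U.card = 2 :=
  exists_tpp_of_tppTestB (gl2Table_isPartialTableOf 3) (lS := [23, 24, 28, 32, 64, 69])
    (lT := [28, 29, 34, 58, 61, 62]) (lU := [28, 73]) (by decide +kernel) (by decide) (by decide)
    (by decide) (by decide +kernel)

/-- **`GL₂(𝔽₃)` realizes `⟨8, 3, 3⟩`** (product `72`): codes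
`S = {14, 16, 17, 25, 28, 31, 39, 78}`, `T = {28, 37, 46}`, `U = {23, 28, 69}`.
[cite: CohnUmans2003, Def. 2.1] -/
theorem gl2f3_realizes_833 :
    ∃ S T U : Finset (Matrix.GeneralLinearGroup (Fin 2) (ZMod 3)),
      TripleProductProperty S T U ∧ S.card = 8 ∧ T.card = 3 ∧ U.card = 3 :=
  exists_tpp_of_tppTestB (gl2Table_isPartialTableOf 3) (lS := [14, 16, 17, 25, 28, 31, 39, 78])
    (lT := [28, 37, 46]) (lU := [23, 28, 69]) (by decide +kernel) (by decide) (by decide)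
    (by decide) (by decide +kernel)

end Literature.Combinatorics.Additive
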